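import Mathlib
import Literature.Probability.LatticeModels.GinibreCharacterExpansion
import HarnessLib

/-!
# The modified Bessel function `I_ν` of REAL order `ν ≥ 0`

`I_ν(w) = (w/2)^ν ∑_{k ≥ 0} (w²/4)^k / (k! Γ(k+ν+1)) = (w/2)^ν P_ν(w²/4)` with the entire series
`P_ν(u) = ∑_k u^k/(k! Γ(k+ν+1)) = ₀F₁(; ν+1; u)/Γ(ν+1)` [DLMF 10.25.2].  This file provides the real-order
companion of the tree's integer-order `besselI` (`Literature.Probability.LatticeModels.besselI`, power series;
`Literature.Analysis.FunctionSpaces.besselI`, Schläfli integral): definitions `besselP`, `besselIR`; positivity;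
the termwise bound `P_ν(u) ≤ cosh(2√u)/Γ(ν+1)` hence `I_ν(w) ≤ (w/2)^ν e^w/Γ(ν+1)` (`w ≥ 0`); the derivative
`P_ν' = P_{ν+1}` (`hasDerivAt_besselP`) and the contiguity relation `u P_{ν+2}(u) + (ν+1) P_{ν+1}(u) = P_ν(u)`
(`besselP_three_term`), which together are the confluent equation `u y'' + (ν+1) y' = y` of `₀F₁(;ν+1;u)`, i.e.
Bessel's equation `w² I'' + w I' = (w² + ν²) I` for `I_ν` [DLMF 10.25.1]; and the identification with the
integer-order series at `ν = n ∈ ℕ` (`besselIR_natCast`).  Purpose: the radial ("Bessel-process") heat kernels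
`t⁻¹ e^{-(x²+y²)/2t} I_ν(xy/t)` of real index [RevuzYor1999, Ch. XI §1], used for the Hartman–Watson law.

## References
* NIST DLMF §10.25 (10.25.1 modified Bessel equation, 10.25.2 the series for `I_ν`). [DLMF]
* D. Revuz, M. Yor, *Continuous Martingales and Brownian Motion*, 3rd ed. (1999), Ch. XI §1. [RevuzYor1999]
-/

noncomputable section

open Filter Topology Real
open scoped Nat BigOperators

namespace Literature.Analysis.SpecialFunctions

/-! ## Definitions -/

/-- The coefficient `1/(k! Γ(k+ν+1))` of the Bessel series. [cite: DLMF, 10.25.2] -/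
def besselPCoeff (ν : ℝ) (k : ℕ) : ℝ := 1 / ((k ! : ℝ) * Real.Gamma (k + ν + 1))

/-- The entire series `P_ν(u) = ∑_k u^k/(k! Γ(k+ν+1))` (`= ₀F₁(;ν+1;u)/Γ(ν+1)`), so that
`I_ν(w) = (w/2)^ν P_ν(w²/4)`. [cite: DLMF, 10.25.2] -/
def besselP (ν u : ℝ) : ℝ := ∑' k : ℕ, besselPCoeff ν k * u ^ k

/-- **The modified Bessel function of the first kind of real order**, `I_ν(w) = (w/2)^ν ∑_k (w²/4)^k/(k! Γ(k+ν+1))`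
(real power `(w/2)^ν`; intended for `w ≥ 0`, `ν ≥ 0`). [cite: DLMF, 10.25.2] -/
def besselIR (ν w : ℝ) : ℝ := (w / 2) ^ ν * besselP ν (w ^ 2 / 4)

/-! ## The coefficients -/

/-- `Γ(ν+1+k) ≥ k! Γ(ν+1)` for `ν ≥ 0`. [folklore] -/
private theorem factorial_mul_Gamma_le {ν : ℝ} (hν : 0 ≤ ν) (k : ℕ) :
    (k ! : ℝ) * Real.Gamma (ν + 1) ≤ Real.Gamma (k + ν + 1) := by
  induction k with
  | zero => simp
  | succ k ih =>
    have hpos : 0 < (k : ℝ) + ν + 1 := by positivity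
    have hG : Real.Gamma ((k : ℝ) + 1 + ν + 1) = ((k : ℝ) + ν + 1) * Real.Gamma ((k : ℝ) + ν + 1) := by
      rw [show (k : ℝ) + 1 + ν + 1 = ((k : ℝ) + ν + 1) + 1 by ring, Real.Gamma_add_one hpos.ne']
    push_cast
    rw [hG, Nat.factorial_succ]
    push_cast
    have hG0 : 0 ≤ Real.Gamma (ν + 1) := (Real.Gamma_pos_of_pos (by linarith)).le
    have h1 : ((k : ℝ) + 1) * ((k ! : ℝ) * Real.Gamma (ν + 1)) ≤ ((k : ℝ) + ν + 1) * Real.Gamma ((k : ℝ) + ν + 1) :=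
      mul_le_mul (by linarith) ih (by positivity) hpos.le
    linarith

/-- The coefficients are positive (`ν ≥ 0`). [cite: DLMF, 10.25.2] -/
theorem besselPCoeff_pos {ν : ℝ} (hν : 0 ≤ ν) (k : ℕ) : 0 < besselPCoeff ν k := by
  unfold besselPCoeff
  have : 0 < Real.Gamma ((k : ℝ) + ν + 1) := Real.Gamma_pos_of_pos (by positivity)
  positivity

/-- `1/(k! Γ(k+ν+1)) ≤ 1/((k!)² Γ(ν+1)) ≤ 1/(k! Γ(ν+1))`. [cite: DLMF, 10.25.2] -/
theorem besselPCoeff_le {ν : ℝ} (hν : 0 ≤ ν) (k : ℕ) :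
    besselPCoeff ν k ≤ 1 / ((k ! : ℝ) * ((k ! : ℝ) * Real.Gamma (ν + 1))) := by
  unfold besselPCoeff
  have hk : (0 : ℝ) < k ! := by exact_mod_cast Nat.factorial_pos k
  have hG : 0 < Real.Gamma (ν + 1) := Real.Gamma_pos_of_pos (by linarith)
  exact one_div_le_one_div_of_le (by positivity) (mul_le_mul_of_nonneg_left (factorial_mul_Gamma_le hν k) hk.le)

/-- The coefficient identities behind `P_ν' = P_{ν+1}`: `(k+1) c_ν(k+1) = c_{ν+1}(k)`. [cite: DLMF, 10.25.2] -/
theorem besselPCoeff_succ_mul {ν : ℝ} (k : ℕ) :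
    besselPCoeff ν (k + 1) * ((k : ℝ) + 1) = besselPCoeff (ν + 1) k := by
  unfold besselPCoeff
  have hk : ((k + 1)! : ℝ) = ((k : ℝ) + 1) * (k ! : ℝ) := by
    rw [Nat.factorial_succ]; push_cast; ring
  rw [hk]
  have h2 : ((k + 1 : ℕ) : ℝ) + ν + 1 = (k : ℝ) + (ν + 1) + 1 := by push_cast; ring
  rw [h2]
  have hk0 : (k : ℝ) + 1 ≠ 0 := by positivity
  field_simp

/-- The contiguity of the coefficients: `c_{ν+2}(k) + (ν+1) c_{ν+1}(k+1) = c_ν(k+1)` (`ν ≥ 0`), i.e.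
`Γ(k+ν+3) = (k+ν+2) Γ(k+ν+2)`. [cite: DLMF, 10.25.2] -/
theorem besselPCoeff_three_term {ν : ℝ} (hν : 0 ≤ ν) (k : ℕ) :
    besselPCoeff (ν + 2) k + (ν + 1) * besselPCoeff (ν + 1) (k + 1) = besselPCoeff ν (k + 1) := by
  unfold besselPCoeff
  have hpos : 0 < (k : ℝ) + 1 + ν + 1 := by positivity
  have e1 : ((k : ℝ) + (ν + 2) + 1) = ((k : ℝ) + 1 + ν + 1) + 1 := by ring
  have e2 : (((k + 1 : ℕ) : ℝ) + (ν + 1) + 1) = ((k : ℝ) + 1 + ν + 1) + 1 := by push_cast; ring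
  have e3 : (((k + 1 : ℕ) : ℝ) + ν + 1) = (k : ℝ) + 1 + ν + 1 := by push_cast; ring
  rw [e1, e2, e3, Real.Gamma_add_one hpos.ne']
  have hk : ((k + 1)! : ℝ) = ((k : ℝ) + 1) * (k ! : ℝ) := by
    rw [Nat.factorial_succ]; push_cast; ring
  rw [hk]
  have hG : 0 < Real.Gamma ((k : ℝ) + 1 + ν + 1) := Real.Gamma_pos_of_pos hpos
  have hkf : (0 : ℝ) < k ! := by exact_mod_cast Nat.factorial_pos k
  field_simp
  ring

/-! ## Summability and positivity -/

/-- The Bessel series converges absolutely, dominated by the exponential series. [cite: DLMF, 10.25.2] -/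
theorem summable_besselP {ν : ℝ} (hν : 0 ≤ ν) (u : ℝ) :
    Summable fun k : ℕ => besselPCoeff ν k * u ^ k := by
  have hG : 0 < Real.Gamma (ν + 1) := Real.Gamma_pos_of_pos (by linarith)
  refine Summable.of_norm_bounded ((Real.summable_pow_div_factorial |u|).mul_left (1 / Real.Gamma (ν + 1)))
    fun k => ?_
  rw [Real.norm_eq_abs, abs_mul, abs_of_pos (besselPCoeff_pos hν k), abs_pow]
  have hk : (1 : ℝ) ≤ k ! := by exact_mod_cast Nat.succ_le_of_lt (Nat.factorial_pos k)
  have hkf : (0 : ℝ) < k ! := by positivity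
  calc besselPCoeff ν k * |u| ^ k ≤ 1 / ((k ! : ℝ) * ((k ! : ℝ) * Real.Gamma (ν + 1))) * |u| ^ k :=
        mul_le_mul_of_nonneg_right (besselPCoeff_le hν k) (by positivity)
    _ ≤ 1 / ((k ! : ℝ) * (1 * Real.Gamma (ν + 1))) * |u| ^ k := by
        gcongr
    _ = 1 / Real.Gamma (ν + 1) * (|u| ^ k / k !) := by field_simp

/-- The series sums to `P_ν`. [cite: DLMF, 10.25.2] -/
theorem hasSum_besselP {ν : ℝ} (hν : 0 ≤ ν) (u : ℝ) :
    HasSum (fun k : ℕ => besselPCoeff ν k * u ^ k) (besselP ν u) :=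
  (summable_besselP hν u).hasSum

/-- `P_ν(u) > 0` for `u ≥ 0` (all terms nonnegative, the constant term `1/Γ(ν+1) > 0`). [cite: DLMF, 10.25.2] -/
theorem besselP_pos {ν : ℝ} (hν : 0 ≤ ν) {u : ℝ} (hu : 0 ≤ u) : 0 < besselP ν u := by
  refine (summable_besselP hν u).tsum_pos (fun k => mul_nonneg (besselPCoeff_pos hν k).le (pow_nonneg hu k)) 0 ?_
  simpa using besselPCoeff_pos hν 0

/-- `P_ν(0) = 1/Γ(ν+1)`. [cite: DLMF, 10.25.2] -/
theorem besselP_zero_right (ν : ℝ) : besselP ν 0 = 1 / Real.Gamma (ν + 1) := by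
  rw [besselP, tsum_eq_single 0 fun k hk => by simp [hk]]
  simp [besselPCoeff]

/-- `I_ν(w) > 0` for `w > 0`. [cite: DLMF, 10.25.2] -/
theorem besselIR_pos {ν : ℝ} (hν : 0 ≤ ν) {w : ℝ} (hw : 0 < w) : 0 < besselIR ν w :=
  mul_pos (Real.rpow_pos_of_pos (by positivity) ν) (besselP_pos hν (by positivity))

/-- `I_ν(w) ≥ 0` for `w ≥ 0`. [cite: DLMF, 10.25.2] -/
theorem besselIR_nonneg {ν : ℝ} (hν : 0 ≤ ν) {w : ℝ} (hw : 0 ≤ w) : 0 ≤ besselIR ν w :=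
  mul_nonneg (Real.rpow_nonneg (by positivity) ν) (besselP_pos hν (by positivity)).le

/-! ## The exponential bound -/

/-- Termwise domination by the `cosh` series: `P_ν(u) ≤ cosh(2√u)/Γ(ν+1)` for `u ≥ 0`, from
`1/(k!Γ(k+ν+1)) ≤ 1/((k!)²Γ(ν+1))` and `(k!)² 4^k ≥ (2k)!`. [cite: DLMF, 10.25.2] -/
theorem besselP_le_cosh {ν : ℝ} (hν : 0 ≤ ν) {u : ℝ} (hu : 0 ≤ u) :
    besselP ν u ≤ Real.cosh (2 * Real.sqrt u) / Real.Gamma (ν + 1) := by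
  have hG : 0 < Real.Gamma (ν + 1) := Real.Gamma_pos_of_pos (by linarith)
  have hcosh : HasSum (fun k : ℕ => (2 * Real.sqrt u) ^ (2 * k) / ((2 * k)! : ℝ) / Real.Gamma (ν + 1))
      (Real.cosh (2 * Real.sqrt u) / Real.Gamma (ν + 1)) :=
    (Real.hasSum_cosh (2 * Real.sqrt u)).div_const _
  refine hasSum_le (fun k => ?_) (hasSum_besselP hν u) hcosh
  have hsq : (2 * Real.sqrt u) ^ (2 * k) = 4 ^ k * u ^ k := by
    rw [pow_mul, mul_pow, Real.sq_sqrt hu]; norm_num [mul_pow]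
  rw [hsq]
  -- `(2k)! ≤ 4^k (k!)²`
  have hcomb : ((2 * k)! : ℝ) ≤ 4 ^ k * ((k ! : ℝ) * k !) := by
    have h := Nat.choose_le_two_pow (2 * k) k  -- C(2k,k) ≤ 2^{2k} = 4^k
    have hc : ((2 * k).choose k : ℝ) * ((k ! : ℝ) * k !) = (2 * k)! := by
      have := Nat.choose_mul_factorial_mul_factorial (show k ≤ 2 * k by omega)
      rw [show 2 * k - k = k by omega] at this
      exact_mod_cast (by rw [← this]; ring)
    have h4 : ((2 : ℝ) ^ (2 * k)) = 4 ^ k := by rw [pow_mul]; norm_num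
    calc ((2 * k)! : ℝ) = ((2 * k).choose k : ℝ) * ((k ! : ℝ) * k !) := hc.symm
      _ ≤ (2 : ℝ) ^ (2 * k) * ((k ! : ℝ) * k !) := by
          gcongr
          exact_mod_cast h
      _ = 4 ^ k * ((k ! : ℝ) * k !) := by rw [h4]
  have hkf : (0 : ℝ) < k ! := by exact_mod_cast Nat.factorial_pos k
  have h2kf : (0 : ℝ) < (2 * k)! := by exact_mod_cast Nat.factorial_pos (2 * k)
  calc besselPCoeff ν k * u ^ k ≤ 1 / ((k ! : ℝ) * ((k ! : ℝ) * Real.Gamma (ν + 1))) * u ^ k :=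
        mul_le_mul_of_nonneg_right (besselPCoeff_le hν k) (pow_nonneg hu k)
    _ ≤ (4 ^ k / ((2 * k)! : ℝ)) / Real.Gamma (ν + 1) * u ^ k := by
        refine mul_le_mul_of_nonneg_right ?_ (pow_nonneg hu k)
        rw [div_div, div_le_div_iff₀ (by positivity) (by positivity), one_mul]
        calc ((2 * k)! : ℝ) * Real.Gamma (ν + 1) ≤ 4 ^ k * ((k ! : ℝ) * k !) * Real.Gamma (ν + 1) :=
              mul_le_mul_of_nonneg_right hcomb hG.le
          _ = 4 ^ k * ((k ! : ℝ) * ((k ! : ℝ) * Real.Gamma (ν + 1))) := by ring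
    _ = 4 ^ k * u ^ k / ((2 * k)! : ℝ) / Real.Gamma (ν + 1) := by ring

/-- **`I_ν(w) ≤ (w/2)^ν e^w / Γ(ν+1)`** for `w ≥ 0`, `ν ≥ 0`. [cite: DLMF, 10.25.2] -/
theorem besselIR_le_rpow_mul_exp {ν : ℝ} (hν : 0 ≤ ν) {w : ℝ} (hw : 0 ≤ w) :
    besselIR ν w ≤ (w / 2) ^ ν * Real.exp w / Real.Gamma (ν + 1) := by
  unfold besselIR
  have h1 := besselP_le_cosh hν (u := w ^ 2 / 4) (by positivity)
  have hsqrt : 2 * Real.sqrt (w ^ 2 / 4) = w := by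
    rw [show w ^ 2 / 4 = (w / 2) ^ 2 by ring, Real.sqrt_sq (by positivity)]; ring
  rw [hsqrt] at h1
  have h2 : Real.cosh w ≤ Real.exp w := by
    rw [Real.cosh_eq]
    have := Real.exp_nonneg (-w)
    have : Real.exp (-w) ≤ Real.exp w := Real.exp_le_exp.2 (by linarith)
    linarith
  have hG : 0 < Real.Gamma (ν + 1) := Real.Gamma_pos_of_pos (by linarith)
  calc (w / 2) ^ ν * besselP ν (w ^ 2 / 4) ≤ (w / 2) ^ ν * (Real.cosh w / Real.Gamma (ν + 1)) :=
        mul_le_mul_of_nonneg_left h1 (Real.rpow_nonneg (by positivity) ν)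
    _ ≤ (w / 2) ^ ν * (Real.exp w / Real.Gamma (ν + 1)) := by gcongr
    _ = (w / 2) ^ ν * Real.exp w / Real.Gamma (ν + 1) := by ring

/-! ## The derivative `P_ν' = P_{ν+1}` and the confluent equation -/

/-- Summability of the differentiated exponential majorant `k R^{k-1}/k!`. [folklore] -/
private theorem summable_mul_pow_pred_div_factorial (R : ℝ) :
    Summable fun k : ℕ => (k : ℝ) * R ^ (k - 1) / k ! := by
  have h : Summable fun k : ℕ => (((k + 1 : ℕ) : ℝ)) * R ^ (k + 1 - 1) / ((k + 1)! : ℝ) := by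
    refine (Real.summable_pow_div_factorial R).congr fun k => ?_
    rw [Nat.factorial_succ]; push_cast
    have : (k : ℝ) + 1 ≠ 0 := by positivity
    have hk : (k ! : ℝ) ≠ 0 := by positivity
    field_simp
  exact (summable_nat_add_iff 1).1 h

/-- **`P_ν' = P_{ν+1}`**: the series may be differentiated termwise. [cite: DLMF, 10.25.2] -/
theorem hasDerivAt_besselP {ν : ℝ} (hν : 0 ≤ ν) (u : ℝ) :
    HasDerivAt (besselP ν) (besselP (ν + 1) u) u := by
  set R : ℝ := |u| + 1 with hR
  have hG : 0 < Real.Gamma (ν + 1) := Real.Gamma_pos_of_pos (by linarith)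
  -- termwise derivatives and their bound on the ball `|y| < R`
  have hderiv : ∀ (k : ℕ) (y : ℝ), y ∈ Metric.ball (0 : ℝ) R →
      HasDerivAt (fun y => besselPCoeff ν k * y ^ k) (besselPCoeff ν k * ((k : ℝ) * y ^ (k - 1))) y :=
    fun k y _ => (hasDerivAt_pow k y).const_mul _
  have hbound : ∀ (k : ℕ) (y : ℝ), y ∈ Metric.ball (0 : ℝ) R →
      ‖besselPCoeff ν k * ((k : ℝ) * y ^ (k - 1))‖ ≤ 1 / Real.Gamma (ν + 1) * ((k : ℝ) * R ^ (k - 1) / k !) := by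
    intro k y hy
    rw [Metric.mem_ball, dist_zero_right, Real.norm_eq_abs] at hy
    rw [Real.norm_eq_abs, abs_mul, abs_of_pos (besselPCoeff_pos hν k), abs_mul, abs_pow,
      abs_of_nonneg (Nat.cast_nonneg k)]
    have hkf : (0 : ℝ) < k ! := by exact_mod_cast Nat.factorial_pos k
    have hk1 : (1 : ℝ) ≤ k ! := by exact_mod_cast Nat.succ_le_of_lt (Nat.factorial_pos k)
    calc besselPCoeff ν k * ((k : ℝ) * |y| ^ (k - 1))
        ≤ 1 / ((k ! : ℝ) * ((k ! : ℝ) * Real.Gamma (ν + 1))) * ((k : ℝ) * R ^ (k - 1)) := by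
          refine mul_le_mul (besselPCoeff_le hν k) ?_ (by positivity) (by positivity)
          exact mul_le_mul_of_nonneg_left (pow_le_pow_left₀ (abs_nonneg y) hy.le _) (Nat.cast_nonneg k)
      _ ≤ 1 / ((k ! : ℝ) * (1 * Real.Gamma (ν + 1))) * ((k : ℝ) * R ^ (k - 1)) := by gcongr
      _ = 1 / Real.Gamma (ν + 1) * ((k : ℝ) * R ^ (k - 1) / k !) := by field_simp
  have h := hasDerivAt_tsum_of_isPreconnected
    ((summable_mul_pow_pred_div_factorial R).mul_left (1 / Real.Gamma (ν + 1))) Metric.isOpen_ball (Metric.isPreconnected_ball) hderiv hbound (Metric.mem_ball_self (by positivity))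
    (summable_besselP hν 0) (y := u) (by rw [Metric.mem_ball, dist_zero_right, Real.norm_eq_abs]; linarith)
  -- identify the derivative series with `P_{ν+1}`
  have hser : ∑' k : ℕ, besselPCoeff ν k * ((k : ℝ) * u ^ (k - 1)) = besselP (ν + 1) u := by
    have hs : Summable fun k : ℕ => besselPCoeff ν k * ((k : ℝ) * u ^ (k - 1)) := by
      refine Summable.of_norm_bounded
        ((summable_mul_pow_pred_div_factorial R).mul_left (1 / Real.Gamma (ν + 1))) fun k => ?_
      exact hbound k u (by rw [Metric.mem_ball, dist_zero_right, Real.norm_eq_abs]; linarith)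
    rw [hs.tsum_eq_zero_add]
    simp only [Nat.cast_zero, zero_mul, mul_zero, zero_add, Nat.add_sub_cancel]
    rw [besselP]
    refine tsum_congr fun k => ?_
    rw [← besselPCoeff_succ_mul k]
    push_cast
    ring
  rw [hser] at h
  exact h

/-- `P_ν` is differentiable. [cite: DLMF, 10.25.2] -/
theorem differentiable_besselP {ν : ℝ} (hν : 0 ≤ ν) : Differentiable ℝ (besselP ν) :=
  fun u => (hasDerivAt_besselP hν u).differentiableAt

/-- `deriv P_ν = P_{ν+1}`. [cite: DLMF, 10.25.2] -/
theorem deriv_besselP {ν : ℝ} (hν : 0 ≤ ν) : deriv (besselP ν) = besselP (ν + 1) :=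
  funext fun u => (hasDerivAt_besselP hν u).deriv

/-- `P_ν` is continuous. [cite: DLMF, 10.25.2] -/
theorem continuous_besselP {ν : ℝ} (hν : 0 ≤ ν) : Continuous (besselP ν) :=
  (differentiable_besselP hν).continuous

/-- **The contiguity relation** `u P_{ν+2}(u) + (ν+1) P_{ν+1}(u) = P_ν(u)` (`ν ≥ 0`): with `P' = P_{ν+1}` this is the
confluent equation `u y'' + (ν+1) y' = y` of `₀F₁(;ν+1;u)`, i.e. Bessel's equation for `I_ν`. [cite: DLMF, 10.25.1] -/
theorem besselP_three_term {ν : ℝ} (hν : 0 ≤ ν) (u : ℝ) :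
    u * besselP (ν + 2) u + (ν + 1) * besselP (ν + 1) u = besselP ν u := by
  have h2 := hasSum_besselP (show 0 ≤ ν + 2 by linarith) u
  have h1 := hasSum_besselP (show 0 ≤ ν + 1 by linarith) u
  have h0 := hasSum_besselP hν u
  -- `u P_{ν+2}(u) = ∑_k c_{ν+2}(k) u^{k+1}`, reindexed to start at `k = 1`
  have hA : HasSum (fun k : ℕ => besselPCoeff (ν + 2) k * u ^ (k + 1)) (u * besselP (ν + 2) u) := by
    have := h2.mul_left u
    refine this.congr_fun fun k => ?_
    ring
  -- split off the `k = 0` terms of `P_{ν+1}` and `P_ν`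
  have h1' := (hasSum_nat_add_iff' 1).2 h1
  have h0' := (hasSum_nat_add_iff' 1).2 h0
  simp only [Finset.range_one, Finset.sum_singleton, pow_zero, mul_one] at h1' h0'
  have hc0 : besselPCoeff ν 0 = (ν + 1) * besselPCoeff (ν + 1) 0 := by
    unfold besselPCoeff
    simp only [Nat.factorial_zero, Nat.cast_one, one_mul, Nat.cast_zero, zero_add]
    rw [show ν + 1 + 1 = (ν + 1) + 1 by ring, Real.Gamma_add_one (by linarith : ν + 1 ≠ 0)]
    have : 0 < Real.Gamma (ν + 1) := Real.Gamma_pos_of_pos (by linarith)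
    field_simp
  -- termwise identity for `k ≥ 1`
  have hsum : HasSum (fun k : ℕ => besselPCoeff (ν + 2) k * u ^ (k + 1) +
      (ν + 1) * (besselPCoeff (ν + 1) (k + 1) * u ^ (k + 1))) (besselP ν u - besselPCoeff ν 0) := by
    refine h0'.congr_fun fun k => ?_
    rw [← besselPCoeff_three_term hν k]
    ring
  have hB := hA.add ((h1'.mul_left (ν + 1)))
  have huniq := hB.unique hsum
  rw [hc0] at huniq
  linarith

/-! ## Identification with the integer-order series -/

/-- At integer order the real-order series is the tree's `besselI`: `I_n(w) = ∑_k (w/2)^{2k+n}/(k!(k+n)!)`.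
[cite: DLMF, 10.25.2] -/
theorem besselIR_natCast (n : ℕ) (w : ℝ) :
    besselIR n w = Literature.Probability.LatticeModels.besselI n w := by
  rw [besselIR, Literature.Probability.LatticeModels.besselI, Real.rpow_natCast, besselP, ← tsum_mul_left]
  refine tsum_congr fun k => ?_
  rw [Literature.Probability.LatticeModels.besselITerm, besselPCoeff, Int.natAbs_natCast,
    show ((k : ℝ) + (n : ℝ) + 1) = ((k + n : ℕ) : ℝ) + 1 by push_cast; ring, Real.Gamma_nat_eq_factorial]
  rw [pow_add, pow_mul, show (w / 2) ^ 2 = w ^ 2 / 4 by ring]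
  ring

end Literature.Analysis.SpecialFunctions

end
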